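import Literature.Topology.FourManifolds.RegularFibreMorsePerturbation
import HarnessLib

/-!
# Product-chart Morse data — helpers `helper_sixCrit_prodChart`, `helper_sixCrit_extend` of stub
`stub_sixCrit` (line `Sketch`, crux `SblfDescent.RungOne`)

(Crux item stmt-SmoothPoincare4-18531; skeleton `Cruxes/RungOne/Lines/Sketch.lean`.)

Generic differential topology behind the six-point Morse function of `stub_sixCrit`: a smooth
embedding `ι : S² × ℝ² ↪ X⁴` with OPEN range (the product structure of the sphere side of a
genus-one simplified broken Lefschetz fibration) is a diffeomorphism onto its range, so

* `exists_productChart_of_isSmoothEmbedding` — for a chart `φ` of `S²` and a linear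
  isomorphism `J : ℝ⁴ ≃ ℝ² × ℝ²`, `y ↦ J⁻¹((ι⁻¹ y).2, φ (ι⁻¹ y).1)` is a local diffeomorphism of
  `X` onto an open subset of `ℝ⁴` (Ehresmann product coordinates, Bröcker–Jänich 1982, (8.12));
* `morseData_of_prod_structure` / **`helper_sixCrit_prodChart`** — if
  `G (ι (x, w)) = λ(w) + ε ρ(w) μ(x)` identically, then `ι (x, w)` is critical for `G` iff
  `Dλ_w + ε μ(x) Dρ_w = 0` and (`ε ρ(w) = 0` or `x` is critical for `μ`); and where `ρ ≡ 1`
  near `w` (`ε > 0`) the Hessian at a critical point is the block sum `D²λ_w ⊕ ε D²μ_x`: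
  nondegenerate when both blocks are, of index `ind_w λ + ind_x μ` (Milnor 1963, §2–§3; the
  block-sum algebra is the tree's `RegularFibreMorsePerturbation.lean`);
* `contMDiff_add_extend` / **`helper_sixCrit_extend`** — `g + (h extended by 0 off range ι)` is
  `C^∞` on `X` when `h` vanishes off `S² × K`, `K` compact, and has the germ of `g` off
  `ι(S² × K)`.

References: J. Milnor, *Morse theory* (1963), §2–§3 [Milnor1963]; T. Bröcker, K. Jänich,
*Introduction to Differential Topology* (1982), (8.12) [BrockerJanichIDT1982].
-/

set_option linter.dupNamespace false

noncomputable section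

open scoped Manifold ContDiff Topology RealInnerProductSpace
open Set Function Literature.Topology.FourManifolds Literature.AlgebraicTopology.SingularHomology

namespace Summit.SmoothPoincare4.SmoothPoincare4.Cruxes.RungOne.Sketch

/-- Local notation: `𝔼 n` is the model Euclidean space `EuclideanSpace ℝ (Fin n)`. -/
local notation "𝔼 " n:arg => EuclideanSpace ℝ (Fin n)

/-- Local notation: `𝕊²`, the unit sphere of `ℝ³`. -/
local notation "𝕊²" => (Metric.sphere (0 : EuclideanSpace ℝ (Fin 3)) (1 : ℝ))

attribute [local instance] Literature.Topology.FourManifolds.fact_finrank_euclideanSpace_succ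

section ProductChart

variable {X : Type*} [TopologicalSpace X] [ChartedSpace (𝔼 4) X]

/-- **Product chart of a smooth open embedding `ι : S² × ℝ² ↪ X⁴`.**  For a chart `φ` of the
maximal atlas of `S²` and a linear isomorphism `J : ℝ⁴ ≃ ℝ² × ℝ²`, the map
`y ↦ J⁻¹ ((ι⁻¹ y).2, φ (ι⁻¹ y).1)` is a local diffeomorphism of `X` onto an open subset of `ℝ⁴`
(an open partial homeomorphism, `C^∞` with `C^∞` inverse `u ↦ ι (φ⁻¹ (J u).2, (J u).1)`),
defined on `ι (φ.source × ℝ²)`: the inverse of a smooth embedding is smooth on its (open)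
range (`Literature.Geometry.Manifold.contMDiffOn_invFun_range`).  Ehresmann product coordinates,
Bröcker–Jänich 1982, (8.12). [cite: BrockerJanichIDT1982, (8.12)] -/
theorem exists_productChart_of_isSmoothEmbedding [IsManifold (𝓡 4) ∞ X] {ι : 𝕊² × 𝔼 2 → X}
    (hemb : Manifold.IsSmoothEmbedding ((𝓡 2).prod (𝓡 2)) (𝓡 4) ∞ ι) (hopen : IsOpen (range ι))
    {φ : OpenPartialHomeomorph 𝕊² (𝔼 2)} (hφ : φ ∈ IsManifold.maximalAtlas (𝓡 2) ∞ 𝕊²)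
    (J : 𝔼 4 ≃L[ℝ] 𝔼 2 × 𝔼 2) :
    ∃ Θ : OpenPartialHomeomorph X (𝔼 4),
      Θ.source = ι '' (φ.source ×ˢ univ) ∧
      (∀ p : 𝕊² × 𝔼 2, p.1 ∈ φ.source → Θ (ι p) = J.symm (p.2, φ p.1)) ∧
      (∀ u, Θ.symm u = ι (φ.symm (J u).2, (J u).1)) ∧
      ContMDiffOn (𝓡 4) (𝓡 4) ∞ Θ Θ.source ∧ ContMDiffOn (𝓡 4) (𝓡 4) ∞ Θ.symm Θ.target := by
  haveI : Nonempty (𝕊² × 𝔼 2) := inferInstance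
  have hinj : Injective ι := hemb.isEmbedding.injective
  have hoe : Topology.IsOpenEmbedding ι := ⟨hemb.isEmbedding, hopen⟩
  have hinv : ContMDiffOn (𝓡 4) ((𝓡 2).prod (𝓡 2)) ∞ (invFun ι) (range ι) :=
    Literature.Geometry.Manifold.contMDiffOn_invFun_range hemb
  have hli : ∀ p, invFun ι (ι p) = p := leftInverse_invFun hinj
  set F₁ : X → 𝔼 4 := fun y => J.symm ((invFun ι y).2, φ (invFun ι y).1) with hF₁
  set F₂ : 𝔼 4 → X := fun u => ι (φ.symm (J u).2, (J u).1) with hF₂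
  set src : Set X := ι '' (φ.source ×ˢ univ) with hsrc
  set tgt : Set (𝔼 4) := {u | (J u).2 ∈ φ.target} with htgt
  have hsrc_open : IsOpen src := hoe.isOpenMap _ (φ.open_source.prod isOpen_univ)
  have htgt_open : IsOpen tgt := φ.open_target.preimage (continuous_snd.comp J.continuous)
  have hsrc_sub : src ⊆ range ι := image_subset_range _ _
  have hsrc_fst : ∀ y ∈ src, (invFun ι y).1 ∈ φ.source := by
    rintro _ ⟨p, hp, rfl⟩
    rw [hli]
    exact hp.1
  -- smoothness of `F₁` on `src`
  have hF₁s : ContMDiffOn (𝓡 4) (𝓡 4) ∞ F₁ src := by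
    have h2 : ContMDiffOn (𝓡 4) (𝓡 2) ∞ (fun y => (invFun ι y).2) src :=
      contMDiff_snd.comp_contMDiffOn (hinv.mono hsrc_sub)
    have h1 : ContMDiffOn (𝓡 4) (𝓡 2) ∞ (fun y => (invFun ι y).1) src :=
      contMDiff_fst.comp_contMDiffOn (hinv.mono hsrc_sub)
    have h1' : ContMDiffOn (𝓡 4) 𝓘(ℝ, 𝔼 2) ∞ (fun y => φ (invFun ι y).1) src :=
      (contMDiffOn_of_mem_maximalAtlas hφ).comp h1 hsrc_fst
    exact J.symm.contDiff.contMDiff.comp_contMDiffOn (h2.prodMk_space h1')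
  -- smoothness of `F₂` on `tgt`
  have hF₂s : ContMDiffOn (𝓡 4) (𝓡 4) ∞ F₂ tgt := by
    have h1 : ContMDiff (𝓡 4) (𝓡 2) ∞ (fun u : 𝔼 4 => (J u).1) :=
      (contDiff_fst.comp J.contDiff).contMDiff
    have h2' : ContMDiff (𝓡 4) (𝓡 2) ∞ (fun u : 𝔼 4 => (J u).2) :=
      (contDiff_snd.comp J.contDiff).contMDiff
    have h2 : ContMDiffOn (𝓡 4) (𝓡 2) ∞ (fun u => φ.symm (J u).2) tgt :=
      (contMDiffOn_symm_of_mem_maximalAtlas hφ).comp h2'.contMDiffOn fun u hu => hu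
    have h12 : ContMDiffOn (𝓡 4) ((𝓡 2).prod (𝓡 2)) ∞
        (fun u => (φ.symm (J u).2, (J u).1)) tgt := h2.prodMk h1.contMDiffOn
    exact hemb.contMDiff.comp_contMDiffOn h12
  refine ⟨
    { toFun := F₁
      invFun := F₂
      source := src
      target := tgt
      map_source' := ?_
      map_target' := ?_
      left_inv' := ?_
      right_inv' := ?_
      open_source := hsrc_open
      open_target := htgt_open
      continuousOn_toFun := hF₁s.continuousOn
      continuousOn_invFun := hF₂s.continuousOn }, rfl, ?_, fun u => rfl, hF₁s, hF₂s⟩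
  · rintro _ ⟨p, hp, rfl⟩
    show (J (J.symm _)).2 ∈ φ.target
    rw [J.apply_symm_apply, hli]
    exact φ.map_source hp.1
  · intro u hu
    exact ⟨(φ.symm (J u).2, (J u).1), ⟨φ.map_target hu, mem_univ _⟩, rfl⟩
  · rintro _ ⟨p, hp, rfl⟩
    show F₂ (F₁ (ι p)) = ι p
    simp only [hF₁, hF₂, hli, J.apply_symm_apply, φ.left_inv hp.1, Prod.mk.eta]
  · intro u hu
    show F₁ (F₂ u) = u
    simp only [hF₁, hF₂, hli, φ.right_inv hu, Prod.mk.eta, J.symm_apply_apply]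
  · intro p hp
    show F₁ (ι p) = _
    simp only [hF₁, hli]

/-- **Morse data of `G` in the product structure `ι`.**  If `G (ι (x, w)) = λ w + ε ρ(w) μ(x)`
identically, then (i) `ι (x, w)` is critical for `G` iff `Dλ_w + ε μ(x) Dρ_w = 0` and
(`ε ρ(w) = 0` or `x` is critical for `μ`); (ii) where `ρ ≡ 1` near `w` and `ε > 0`, at a
critical point the Hessian of `G` is the block sum `D²λ_w ⊕ ε D²μ_x` (read in the product
chart `exists_productChart_of_isSmoothEmbedding` through a chart of `S²` at `x`), so it is
nondegenerate when both blocks are, of index `ind_w λ + ind_x μ` (Milnor 1963, §2–§3; block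
sums: `sigNeg_eq_add_of_forall_apply_eq_blockSum`). [cite: Milnor1963, §3]
[cite: BrockerJanichIDT1982, (8.12)] -/
theorem morseData_of_prod_structure [IsManifold (𝓡 4) ∞ X] {ι : 𝕊² × 𝔼 2 → X}
    (hemb : Manifold.IsSmoothEmbedding ((𝓡 2).prod (𝓡 2)) (𝓡 4) ∞ ι) (hopen : IsOpen (range ι))
    {G : X → ℝ} {lam ρ : 𝔼 2 → ℝ} {μ : 𝕊² → ℝ} {ε : ℝ}
    (hlam : ContDiff ℝ ∞ lam) (hρ : ContDiff ℝ ∞ ρ) (hμ : ContMDiff (𝓡 2) 𝓘(ℝ, ℝ) ∞ μ)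
    (hG : ∀ p, G (ι p) = lam p.2 + ε * (ρ p.2 * μ p.1)) (x : 𝕊²) (w : 𝔼 2) :
    (IsMCriticalPt (𝓡 4) G (ι (x, w)) ↔
      (fderiv ℝ lam w + (ε * μ x) • fderiv ℝ ρ w = 0 ∧ (ε * ρ w = 0 ∨ IsMCriticalPt (𝓡 2) μ x))) ∧
    (ρ =ᶠ[𝓝 w] (fun _ => (1 : ℝ)) → 0 < ε → IsMCriticalPt (𝓡 4) G (ι (x, w)) →
      (mhessian (𝓡 2) lam w).Nondegenerate → (mhessian (𝓡 2) μ x).Nondegenerate →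
      (mhessian (𝓡 4) G (ι (x, w))).Nondegenerate ∧
        morseIndex (𝓡 4) G (ι (x, w)) = morseIndex (𝓡 2) lam w + morseIndex (𝓡 2) μ x) := by
  set φ := chartAt (𝔼 2) x with hφ
  have hφatlas : φ ∈ IsManifold.maximalAtlas (𝓡 2) ∞ 𝕊² := IsManifold.chart_mem_maximalAtlas x
  have hφs : ContMDiffOn (𝓡 2) (𝓡 2) ∞ φ φ.source := contMDiffOn_of_mem_maximalAtlas hφatlas
  have hφs' : ContMDiffOn (𝓡 2) (𝓡 2) ∞ φ.symm φ.target :=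
    contMDiffOn_symm_of_mem_maximalAtlas hφatlas
  have hxφ : x ∈ φ.source := mem_chart_source _ x
  set μh : 𝔼 2 → ℝ := μ ∘ φ.symm with hμh
  set v₁ : 𝔼 2 := φ x with hv₁
  have hv₁t : v₁ ∈ φ.target := φ.map_source hxφ
  have hμv : μh v₁ = μ x := by simp only [hμh, hv₁, Function.comp_apply, φ.left_inv hxφ]
  obtain ⟨J⟩ : Nonempty (𝔼 4 ≃L[ℝ] 𝔼 2 × 𝔼 2) :=
    ⟨ContinuousLinearEquiv.ofFinrankEq (by simp [Module.finrank_prod])⟩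
  obtain ⟨Θ, hΘsrc, hΘι, hΘsymm, hΘs, hΘs'⟩ :=
    exists_productChart_of_isSmoothEmbedding hemb hopen hφatlas J
  have hq : ι (x, w) ∈ Θ.source := by
    rw [hΘsrc]; exact ⟨(x, w), ⟨hxφ, mem_univ _⟩, rfl⟩
  have hΘq : Θ (ι (x, w)) = J.symm (w, v₁) := hΘι (x, w) hxφ
  have hJq : J (Θ (ι (x, w))) = (w, v₁) := by rw [hΘq, J.apply_symm_apply]
  -- `μ` read in the chart `φ`, and its Morse data
  have hμh_s : ContDiffOn ℝ ∞ μh φ.target :=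
    contMDiffOn_iff_contDiffOn.1 (hμ.comp_contMDiffOn hφs')
  have hμh_at : ContDiffAt ℝ ∞ μh v₁ := hμh_s.contDiffAt (φ.open_target.mem_nhds hv₁t)
  obtain ⟨hμcrit_iff, hμdata⟩ := morseData_of_localRepresentative (n := 1) (f := μ) hφs hφs'
    hxφ (G := μh) (hμh_at.of_le (by norm_cast)) Filter.EventuallyEq.rfl
  -- the local representative of `G` in `Θ` is the block model
  set Gm : 𝔼 4 → ℝ := fun u => lam (J u).1 + ε * (ρ (J u).1 * μh (J u).2) with hGm
  have hJ1 : ContDiff ℝ ∞ fun u : 𝔼 4 => (J u).1 := contDiff_fst.comp J.contDiff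
  have hJ2 : ContDiff ℝ ∞ fun u : 𝔼 4 => (J u).2 := contDiff_snd.comp J.contDiff
  have hGm_at : ContDiffAt ℝ 2 Gm (Θ (ι (x, w))) := by
    have hA : ContDiffAt ℝ 2 (fun u => lam (J u).1) (Θ (ι (x, w))) :=
      ((hlam.comp hJ1).of_le (by norm_cast)).contDiffAt
    have hB : ContDiffAt ℝ 2 (fun u => ρ (J u).1) (Θ (ι (x, w))) :=
      ((hρ.comp hJ1).of_le (by norm_cast)).contDiffAt
    have hC : ContDiffAt ℝ 2 (fun u => μh (J u).2) (Θ (ι (x, w))) := by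
      have h2 : ContDiffAt ℝ 2 μh ((fun u : 𝔼 4 => (J u).2) (Θ (ι (x, w)))) := by
        rw [show (fun u : 𝔼 4 => (J u).2) (Θ (ι (x, w))) = v₁ by simp only [hJq]]
        exact hμh_at.of_le (by norm_cast)
      exact ContDiffAt.comp (g := μh) (f := fun u : 𝔼 4 => (J u).2) (Θ (ι (x, w))) h2
        (hJ2.of_le (by norm_cast)).contDiffAt
    exact hA.add (contDiffAt_const.mul (hB.mul hC))
  have hfG : G ∘ Θ.symm =ᶠ[𝓝 (Θ (ι (x, w)))] Gm :=
    Filter.Eventually.of_forall fun u => by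
      simp only [Function.comp_apply, hΘsymm, hG, hGm, hμh]
  obtain ⟨hcritG, hdataG⟩ := morseData_of_localRepresentative (n := 3) hΘs hΘs' hq hGm_at hfG
  -- criticality of the block model
  have hcrit_iff : fderiv ℝ Gm (Θ (ι (x, w))) = 0 ↔
      fderiv ℝ lam w + (ε * μ x) • fderiv ℝ ρ w = 0 ∧ (ε * ρ w) • fderiv ℝ μh v₁ = 0 := by
    have hl : DifferentiableAt ℝ lam (J (Θ (ι (x, w)))).1 :=
      hlam.contDiffAt.differentiableAt (by simp)
    have hρd : DifferentiableAt ℝ ρ (J (Θ (ι (x, w)))).1 :=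
      hρ.contDiffAt.differentiableAt (by simp)
    have hμd : DifferentiableAt ℝ μh (J (Θ (ι (x, w)))).2 := by
      rw [hJq]; exact hμh_at.differentiableAt (by simp)
    have key := fderiv_blockModel_eq_zero_iff J ε hl hρd hμd
    rw [hJq] at key
    rw [key, hμv]
  refine ⟨by rw [hcritG, hcrit_iff, smul_eq_zero, hμcrit_iff], fun hρ1 hε hc hndlam hndμ => ?_⟩
  -- on the plateau `ρ ≡ 1` near `w`
  have hρw : ρ w = 1 := hρ1.self_of_nhds
  obtain ⟨-, h2⟩ := (hcritG.trans hcrit_iff).1 hc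
  rw [hρw, mul_one, smul_eq_zero] at h2
  have hμc : IsMCriticalPt (𝓡 2) μ x := hμcrit_iff.2 (h2.resolve_left hε.ne')
  obtain ⟨hndG, hindG⟩ := hdataG hc
  obtain ⟨hB₂nd, hB₂ind⟩ := hμdata hμc
  replace hB₂nd := hB₂nd.1 hndμ
  -- the Hessian of the model is the block sum `D²λ(w) ⊕ ε D²μ̂(v₁)`
  have hHess : ∀ a b, mhessian (𝓡 4) Gm (Θ (ι (x, w))) a b =
      mhessian (𝓡 2) lam w (J a).1 (J b).1 + ε * mhessian (𝓡 2) μh v₁ (J a).2 (J b).2 := by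
    intro a b
    rw [MorseBirth.mhessian_model_apply (n := 3), MorseBirth.mhessian_model_apply (n := 1),
      MorseBirth.mhessian_model_apply (n := 1)]
    have hl2 : ContDiffAt ℝ 2 lam (J (Θ (ι (x, w)))).1 := (hlam.of_le (by norm_cast)).contDiffAt
    have hρev : ρ =ᶠ[𝓝 (J (Θ (ι (x, w)))).1] fun _ => 1 := by rw [hJq]; exact hρ1
    have hμ2 : ContDiffAt ℝ 2 μh (J (Θ (ι (x, w)))).2 := by
      rw [hJq]; exact hμh_at.of_le (by norm_cast)
    rw [fderiv_fderiv_blockModel_apply J ε hl2 hρev hμ2 a b, hJq]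
  have hB₁symm : (mhessian (𝓡 2) lam w).IsSymm := ⟨fun a b => by
    rw [MorseBirth.mhessian_model_apply (n := 1), MorseBirth.mhessian_model_apply (n := 1)]
    exact (hlam.of_le (m := 2) (by norm_cast)).contDiffAt.isSymmSndFDerivAt (by simp) a b⟩
  have hB₂symm : (mhessian (𝓡 2) μh v₁).IsSymm := ⟨fun a b => by
    rw [MorseBirth.mhessian_model_apply (n := 1), MorseBirth.mhessian_model_apply (n := 1)]
    have hμ2 : ContDiffAt ℝ 2 μh v₁ := hμh_at.of_le (by norm_cast)
    exact hμ2.isSymmSndFDerivAt (by simp) a b⟩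
  have hHess' : ∀ a b, mhessian (𝓡 4) Gm (Θ (ι (x, w))) a b =
      mhessian (𝓡 2) lam w (J.toLinearEquiv a).1 (J.toLinearEquiv b).1 +
        ε * mhessian (𝓡 2) μh v₁ (J.toLinearEquiv a).2 (J.toLinearEquiv b).2 := fun a b => by
    simpa using hHess a b
  refine ⟨hndG.2 (nondegenerate_of_forall_apply_eq_blockSum J.toLinearEquiv hε.ne' hndlam hB₂nd
    hHess'), ?_⟩
  rw [hindG, hB₂ind]
  exact sigNeg_eq_add_of_forall_apply_eq_blockSum J.toLinearEquiv hε hB₁symm hB₂symm hHess'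

/-- **Smoothness of a perturbation supported in the product region.**  For a smooth embedding
`ι : S² × ℝ² ↪ X` with open range, `g : X → ℝ` smooth and `h : S² × ℝ² → ℝ` smooth vanishing
off `S² × K` (`K ⊆ ℝ²` compact), the function `g + (h ∘ ι⁻¹ extended by 0)` is `C^∞` on `X`
(on the open range it is `g + h ∘ ι⁻¹` with `ι⁻¹` smooth,
`Literature.Geometry.Manifold.contMDiffOn_invFun_range`; off the compact `ι(S² × K)` it IS
`g`), equals `g (ι p) + h p` at `ι p`, equals `g` off `range ι`, and has the germ of `g` at
every point not in `ι(S² × K)` (Milnor 1963, §2: local perturbations of a smooth function).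
[cite: Milnor1963, §2] -/
theorem contMDiff_add_extend [T2Space X] [IsManifold (𝓡 4) ∞ X] {ι : 𝕊² × 𝔼 2 → X}
    (hemb : Manifold.IsSmoothEmbedding ((𝓡 2).prod (𝓡 2)) (𝓡 4) ∞ ι) (hopen : IsOpen (range ι))
    {g : X → ℝ} (hg : ContMDiff (𝓡 4) 𝓘(ℝ, ℝ) ∞ g) {h : 𝕊² × 𝔼 2 → ℝ}
    (hh : ContMDiff ((𝓡 2).prod (𝓡 2)) 𝓘(ℝ, ℝ) ∞ h) {K : Set (𝔼 2)} (hK : IsCompact K)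
    (hhK : ∀ p, p.2 ∉ K → h p = 0) :
    ContMDiff (𝓡 4) 𝓘(ℝ, ℝ) ∞ (fun y => g y + extend ι h 0 y) ∧
    (∀ p, g (ι p) + extend ι h 0 (ι p) = g (ι p) + h p) ∧
    (∀ y, y ∉ range ι → g y + extend ι h 0 y = g y) ∧
    (∀ y, y ∉ ι '' (univ ×ˢ K) → (fun y => g y + extend ι h 0 y) =ᶠ[𝓝 y] g) := by
  have hinj : Injective ι := hemb.isEmbedding.injective
  have hext : ∀ p, extend ι h 0 (ι p) = h p := fun p => hinj.extend_apply h 0 p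
  have hext' : ∀ y, y ∉ range ι → extend ι h 0 y = 0 := fun y hy => by
    rw [extend_apply' _ _ _ fun ⟨p, hp⟩ => hy ⟨p, hp⟩]; rfl
  set K' : Set X := ι '' (univ ×ˢ K) with hK'def
  have hK' : IsCompact K' := (isCompact_univ.prod hK).image hemb.contMDiff.continuous
  have hGg : ∀ y, y ∉ K' → g y + extend ι h 0 y = g y := by
    intro y hy
    by_cases hyr : y ∈ range ι
    · obtain ⟨p, rfl⟩ := hyr
      have hp : p.2 ∉ K := fun hpK => hy ⟨p, ⟨mem_univ _, hpK⟩, rfl⟩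
      rw [hext, hhK p hp, add_zero]
    · rw [hext' y hyr, add_zero]
  have hev : ∀ y, y ∉ K' → (fun y => g y + extend ι h 0 y) =ᶠ[𝓝 y] g := fun y hy => by
    filter_upwards [hK'.isClosed.isOpen_compl.mem_nhds hy] with z hz
    exact hGg z hz
  refine ⟨fun y => ?_, fun p => by rw [hext], fun y hy => by rw [hext' y hy, add_zero], hev⟩
  by_cases hy : y ∈ K'
  · have hyr : y ∈ range ι := (image_subset_range _ _) hy
    haveI : Nonempty (𝕊² × 𝔼 2) := ⟨hyr.choose⟩
    have hinv := Literature.Geometry.Manifold.contMDiffOn_invFun_range hemb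
    have hform : ContMDiffOn (𝓡 4) 𝓘(ℝ, ℝ) ∞ (fun y => g y + h (invFun ι y)) (range ι) :=
      hg.contMDiffOn.add (hh.comp_contMDiffOn hinv)
    have heq : (fun y => g y + extend ι h 0 y) =ᶠ[𝓝 y] fun y => g y + h (invFun ι y) := by
      filter_upwards [hopen.mem_nhds hyr] with z hz
      obtain ⟨p, rfl⟩ := hz
      rw [hext, leftInverse_invFun hinj]
    exact ((hform y hyr).contMDiffAt (hopen.mem_nhds hyr)).congr_of_eventuallyEq heq
  · exact (hg y).congr_of_eventuallyEq (hev y hy)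

end ProductChart

/-! ### The registered helper stubs -/

/-- **Registered helper `helper_sixCrit_prodChart`** (Morse data of `G (ι (x, w)) =
λ(w) + ε ρ(w) μ(x)` in the product structure `ι`: criticality, and nondegeneracy with index
`ind λ + ind μ` on the plateau `ρ ≡ 1`; Milnor 1963, §2–§3). [cite: Milnor1963, §3] -/
theorem helper_sixCrit_prodChart :
    ∀ (X : Type) [TopologicalSpace X] [ChartedSpace (𝔼 4) X] [IsManifold (𝓡 4) ∞ X]
      (ι : 𝕊² × 𝔼 2 → X), Manifold.IsSmoothEmbedding ((𝓡 2).prod (𝓡 2)) (𝓡 4) ∞ ι →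
      IsOpen (range ι) → ∀ (G : X → ℝ) (lam ρ : 𝔼 2 → ℝ) (μ : 𝕊² → ℝ) (ε : ℝ),
      ContDiff ℝ ∞ lam → ContDiff ℝ ∞ ρ → ContMDiff (𝓡 2) 𝓘(ℝ, ℝ) ∞ μ →
      (∀ p, G (ι p) = lam p.2 + ε * (ρ p.2 * μ p.1)) → ∀ (x : 𝕊²) (w : 𝔼 2),
      (IsMCriticalPt (𝓡 4) G (ι (x, w)) ↔
        (fderiv ℝ lam w + (ε * μ x) • fderiv ℝ ρ w = 0 ∧
          (ε * ρ w = 0 ∨ IsMCriticalPt (𝓡 2) μ x))) ∧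
      (ρ =ᶠ[𝓝 w] (fun _ => (1 : ℝ)) → 0 < ε → IsMCriticalPt (𝓡 4) G (ι (x, w)) →
        (mhessian (𝓡 2) lam w).Nondegenerate → (mhessian (𝓡 2) μ x).Nondegenerate →
        (mhessian (𝓡 4) G (ι (x, w))).Nondegenerate ∧
          morseIndex (𝓡 4) G (ι (x, w)) = morseIndex (𝓡 2) lam w + morseIndex (𝓡 2) μ x) :=
  fun _ _ _ _ _ hemb hopen _ _ _ _ _ hlam hρ hμ hG x w =>
    morseData_of_prod_structure hemb hopen hlam hρ hμ hG x w

/-- **Registered helper `helper_sixCrit_extend`** (smoothness, formulas and germ of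
`g + (h ∘ ι⁻¹ extended by 0)` for `h` supported in `S² × K`, `K` compact; Milnor 1963, §2).
[cite: Milnor1963, §2] -/
theorem helper_sixCrit_extend :
    ∀ (X : Type) [TopologicalSpace X] [T2Space X] [ChartedSpace (𝔼 4) X] [IsManifold (𝓡 4) ∞ X]
      (ι : 𝕊² × 𝔼 2 → X), Manifold.IsSmoothEmbedding ((𝓡 2).prod (𝓡 2)) (𝓡 4) ∞ ι →
      IsOpen (range ι) → ∀ (g : X → ℝ) (h : 𝕊² × 𝔼 2 → ℝ) (K : Set (𝔼 2)),
      ContMDiff (𝓡 4) 𝓘(ℝ, ℝ) ∞ g → ContMDiff ((𝓡 2).prod (𝓡 2)) 𝓘(ℝ, ℝ) ∞ h → IsCompact K →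
      (∀ p, p.2 ∉ K → h p = 0) →
      ContMDiff (𝓡 4) 𝓘(ℝ, ℝ) ∞ (fun y => g y + extend ι h 0 y) ∧
      (∀ p, g (ι p) + extend ι h 0 (ι p) = g (ι p) + h p) ∧
      (∀ y, y ∉ range ι → g y + extend ι h 0 y = g y) ∧
      (∀ y, y ∉ ι '' (univ ×ˢ K) → (fun y => g y + extend ι h 0 y) =ᶠ[𝓝 y] g) :=
  fun _ _ _ _ _ _ hemb hopen _ _ _ hg hh hK hhK => contMDiff_add_extend hemb hopen hg hh hK hhK

end Summit.SmoothPoincare4.SmoothPoincare4.Cruxes.RungOne.Sketch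

end
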